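import Summits.QuantumFields.YangMills.Theorems.BalabanUVNodesN11Sect3SupplySpliceDefs
import Summits.QuantumFields.YangMills.Theorems.BalabanUVNodesN11NoExpansionStepReductionRePinnedUnivECoPH

/-!
# DAG node N11 — GENERIC §2 FRAME: the 𝐓-image law package of a SPLICED witness ACROSS FRAMES (parent history → expansion child); which old-level laws the child's frame
# inherits from the parent's, and the one that it does not (the old boundary term `𝐁^{(k)}` on the child's larger `Ũ^c_k(X)` — LOCATED-SPACEB)

Cell `pub-ymgap`, YM-PLAN Track A (HUMAN RULING D-0062 ∕ D-0149), seat `pub-ymgap-dag-n11-e` (g15; R134 fan-out row N11∕s3), route `BalabanUVNodes` rev 25, item K1⁷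
`StabilityBAtRecordR13SepCoPH` = stmt-QuantumFields-20542 (helper lane, count-neutral).  [III] = [Balaban1988Convergent].  Over 11b ∕ 11c (`Node00.Sect2FrameOfRecord` ∕
`Sect2FormOfRecord`), r11 (`Step.LFHyp ∕ LFNewTerms ∕ LFHypAnalytic`), this seat's `…Sect3SupplySpliceDefs` (`graftAbove`, `zeroRB`, `dropBFrom`) and `…RePinnedUnivECoPH` §0
(`towerOfTerms_space_eq_of_bgI_eq`: the 𝐄∕𝐑-space `U^c_j(X, α₀, α₁)` reads the residual through `bgI` only and no history).

WHY THIS FILE.  [III] §3's supply at an expansion child `s′` of a history `init s′` must deliver `Sect2.LawsT … k` for the 𝐓-image witness on the CHILD's tower of record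
`(S, θ.rzAt p s′, M, s′.Ω)`, while the exposed witness of `ρ_k` carries `Sect2.LawsRT … k` on the PARENT's tower `(S, θ.rzAt p (init s′), M, (init s′).Ω)`.  The two frames share
`bgI`, `bgMS` (def-T `Stage13HParams.rzAt_bgI ∕ _bgMS`, `rfl`) and `Ω_i` for `i ≤ k` (`seq_init_Ω_of_le`), and differ in `Ω_{k+1}` (`≠ ∅` at the child, `= ∅` at the parent).
11b's towers read: `space j X` = `spaceI` (residual through `bgI`, NO history) — so every 𝐄∕𝐑-law transfers; `spaceB j X` = `spaceMS … Ω` whose layers (2.34)∕(2.36)∕(2.39) read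
`Ω_{≤ j}` and whose (2.38) cube family `cubesMS M j Y Ω n` reads `Ω_n, Ω_{n+1}, Ω_{n+2}` for `n < j` — up to `Ω_{j+1}` (print p. 261 «□ ⊂ Ω_n∖Ω_{n+2}, □∩Ω^c_{n+1} ≠ ∅,
n = 1, …, j−1», AS PRINTED).  Hence the `𝐁`-laws transfer at the levels `j < k` (they read `Ω_{≤ k}`) and NOT at `j = k` (reads `Ω_{k+1}`): at an expansion child the space
`Ũ^c_k(X)` has FEWER (2.38) cubes, fewer constraints (ii), and is LARGER — the bound (2.42) and analyticity (2.41)(ii) of the old `𝐁^{(k)}` on it are a genuine obligation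
(LOCATED-SPACEB, bus 2026-08-27 ≈23:10Z; displayed, never asserted).

WHAT THIS FILE PROVES (0 `sorry`, 0 `def`; generic §2 frame `(S, Rz, M, Ω)`, any gauge group).
§1 `layerSet_congr_of_agree` · `cubesMS_congr_of_agree` · `towerOfTerms_spaceB_eq_of_agree` — `Ũ^c_j(X)` along two sequences agreeing up to `j+1`, two residuals with the
   same `bgMS`, any term values: EQUAL · `cubesMS_one_congr` ∕ `towerOfTerms_spaceB_one_eq_of_agree` — at level `1` agreement at `Ω₁` suffices (`Ω₀ = ∅`): LOCATED-SPACEB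
   bites only from `k = 2` on.
§2 ★ `lawsT_towerOfTerms_crossFrame` — `Sect2.LawsT (tower S Rz′ M Ω′ t′) … k` on the CHILD frame from: `Sect2.LawsRT (tower S Rz M Ω t) … k` on the PARENT frame; agreement
   of `t′` with `t` in `𝐄 ∕ 𝐑` at the levels `≤ k` and in `𝐁` at the levels `< k`; the level-`k` `𝐁`-law of `t′` ON THE CHILD FRAME (void at `k = 0`); r11's `Step.LFNewTerms … k`
   and analyticity at `k+1` for `t′` on the child frame · `lfNewTerms_graftAbove` (r11's new-term package does not read the levels
   `≤ k`: it transports from `u` to `graftAbove k t u` on one frame).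
§3 The ZERO new terms: `newEClauses_of_zeroE` (the four level-`(k+1)` 𝐄-clauses for `𝐄^{(k+1)} ≡ 0` from `0 ≤ E₀`) · `lfNewTerms_of_newE_of_noR_of_noB` (r11's package from
   the four 𝐄-clauses, `𝐑^{(k+1)} ≡ 0`, `𝐁^{(k+1)} ≡ 0`, the RG equation, `0 ≤ B₀`, `0 ≤ g_{k+1}`) · `analyticR_of_noR` ∕ `analyticB_of_noB`.

HONEST FRAMING.  Count-neutral kernel bookkeeping on the tree's own objects; no estimate of [III] §3 used or asserted; N11 NOT discharged; K1⁷ NOT closed; counts unmoved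
(typed 28∕28 · discharged 5∕27).  One finite `𝕋⁴_{L^K}` programme at fixed `ε = L^{−K}`; NOT ℝ⁴ ∕ OS ∕ mass-gap ∕ Clay.
Sources: [III] §2 p.262, (2.23)–(2.31) pp.258–260, (2.34)–(2.42) p.261, §3 p.279; [Balaban1987RG1] (0.20) p.256, (1.15) p.266.
-/

noncomputable section

open MeasureTheory
open scoped BigOperators Matrix.Norms.L2Operator

namespace Summit.QuantumFields.YangMills.Theorems.BalabanUVNodesN11Sect3SupplySpliceFrame

open Literature.MathematicalPhysics.QuantumFieldTheory.Balaban1983to89 T4Continuum Node00 Node00.Tk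
open Step B14.Eq227LocalizedTerms
open BalabanUVNodesN11Sect3SupplySpliceDefs
open BalabanUVNodesN11NoExpansionStepReductionRePinnedUnivECoPH (towerOfTerms_space_eq_of_bgI_eq)

/-! ## §1  `Ũ^c_j(X)` along two sequences agreeing up to `j+1` -/

section SpaceB

variable {P : Params}

/-- **THE LAYERS (2.34)∕(2.36)∕(2.39) OF `Ũ^c_j(X)` READ `Ω_{≤ j}` ONLY**: two sequences agreeing up to `j` give the same layer function `n ↦ X∩(Ω_n∖Ω_{n+1})` (`n < j`),
`X∩Ω_j` (`n = j`). [cite: Balaban1988Convergent, (2.34)–(2.39) p.261 (bookkeeping)] -/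
theorem layerSet_congr_of_agree (j : ℕ) (Y : Set (Site P 0)) {Ω Ω' : ℕ → Set (Site P 0)} (h : ∀ i, i ≤ j → Ω' i = Ω i) :
    Sect2.layerSet j Y Ω' = Sect2.layerSet j Y Ω := by
  funext n
  unfold Sect2.layerSet
  by_cases hn : n < j
  · rw [if_pos hn, if_pos hn, h n hn.le, h (n + 1) hn]
  · rw [if_neg hn, if_neg hn]
    by_cases hn' : n = j
    · rw [if_pos hn', if_pos hn', h j le_rfl]
    · rw [if_neg hn', if_neg hn']

/-- **THE (2.38) CUBE FAMILY OF `Ũ^c_j(X)` READS `Ω_{≤ j+1}`** («□ ⊂ Ω_n∖Ω_{n+2}, □∩Ω^c_{n+1} ≠ ∅, n = 1, …, j−1, or □ ⊂ Ω_j», AS PRINTED — at the layer `n = j−1` the family reads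
`Ω_{j+1}`): two sequences agreeing up to `j+1` give the same cube family. [cite: Balaban1988Convergent, (2.38) p.261 (bookkeeping)] -/
theorem cubesMS_congr_of_agree (M j : ℕ) (Y : Set (Site P 0)) {Ω Ω' : ℕ → Set (Site P 0)} (h : ∀ i, i ≤ j + 1 → Ω' i = Ω i) :
    Sect2.cubesMS M j Y Ω' = Sect2.cubesMS M j Y Ω := by
  funext n
  ext C
  simp only [Sect2.cubesMS, Set.mem_setOf_eq]
  constructor
  · rintro ⟨a, ha, hne, hcond, hC⟩
    refine ⟨a, ha, hne, ?_, hC⟩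
    rcases hcond with ⟨hn, hsub, hne'⟩ | ⟨hn, hsub⟩
    · refine Or.inl ⟨hn, ?_, ?_⟩
      · rwa [← h n (by omega), ← h (n + 2) (by omega)]
      · rwa [← h (n + 1) (by omega)]
    · exact Or.inr ⟨hn, by rwa [← h j (by omega)]⟩
  · rintro ⟨a, ha, hne, hcond, hC⟩
    refine ⟨a, ha, hne, ?_, hC⟩
    rcases hcond with ⟨hn, hsub, hne'⟩ | ⟨hn, hsub⟩
    · refine Or.inl ⟨hn, ?_, ?_⟩
      · rwa [h n (by omega), h (n + 2) (by omega)]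
      · rwa [h (n + 1) (by omega)]
    · exact Or.inr ⟨hn, by rwa [h j (by omega)]⟩

/-- **AT LEVEL `j = 1` THE (2.38) CUBE FAMILY READS `Ω₁` ONLY** once `Ω₀ = ∅` (the off-window convention of r11's `Seq`): the layer-`0` cubes «□ ⊂ Ω₀∖Ω₂» are cubes
inside `∅` — there are none, whatever `Ω₂` is — so two sequences with `Ω₀ = Ω′₀ = ∅` and `Ω′₁ = Ω₁` have the same family at level `1` (LOCATED-SPACEB bites only from `k = 2` on).
[cite: Balaban1988Convergent, (2.38) p.261, (2.1) p.254 (bookkeeping)] -/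
theorem cubesMS_one_congr (M : ℕ) (Y : Set (Site P 0)) {Ω Ω' : ℕ → Set (Site P 0)} (h0 : Ω 0 = ∅) (h0' : Ω' 0 = ∅) (h1 : Ω' 1 = Ω 1) :
    Sect2.cubesMS M 1 Y Ω' = Sect2.cubesMS M 1 Y Ω := by
  funext n
  ext C
  simp only [Sect2.cubesMS, Set.mem_setOf_eq]
  constructor
  · rintro ⟨a, ha, hne, hcond, hC⟩
    refine ⟨a, ha, hne, ?_, hC⟩
    rcases hcond with ⟨hn, hsub, -⟩ | ⟨hn, hsub⟩
    · exfalso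
      obtain rfl : n = 0 := Nat.lt_one_iff.mp hn
      rw [h0', Set.empty_sdiff] at hsub
      obtain ⟨x, hx⟩ := hne
      exact (Set.mem_empty_iff_false x).mp (hsub hx.1)
    · exact Or.inr ⟨hn, by rwa [← h1]⟩
  · rintro ⟨a, ha, hne, hcond, hC⟩
    refine ⟨a, ha, hne, ?_, hC⟩
    rcases hcond with ⟨hn, hsub, -⟩ | ⟨hn, hsub⟩
    · exfalso
      obtain rfl : n = 0 := Nat.lt_one_iff.mp hn
      rw [h0, Set.empty_sdiff] at hsub
      obtain ⟨x, hx⟩ := hne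
      exact (Set.mem_empty_iff_false x).mp (hsub hx.1)
    · exact Or.inr ⟨hn, by rwa [h1]⟩

variable {𝔸 : Type*} [NormedRing 𝔸] [NormedAlgebra ℂ 𝔸] [CompleteSpace 𝔸] {V : Type*} {M : ℕ} {G : Type*} [GaugeGroup G]

/-- **`Ũ^c_j(X)` OF THE §2 TOWER ALONG TWO SEQUENCES AGREEING UP TO `j+1` AND TWO RESIDUALS WITH THE SAME `bgMS` IS THE SAME SPACE** (any term values: 11b's
`towerOfTerms … .spaceB j X = spaceMS S Rz M j (domSites …) Ω` reads the residual through `bgMS` and the sequence through the layers and the (2.38) cubes only).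
[cite: Balaban1988Convergent, (2.34)–(2.39), (2.41)(ii) p.261 (bookkeeping)] -/
theorem towerOfTerms_spaceB_eq_of_agree (S : Sect2.Setting 𝔸 G) {Rz Rz' : Sect2.Residual P 𝔸} (hbg : Rz'.bgMS = Rz.bgMS) {Ω Ω' : ℕ → Set (Site P 0)} {j : ℕ}
    (hΩ : ∀ i, i ≤ j + 1 → Ω' i = Ω i) (t t' : Sect2.TermValues P 𝔸 V M) (X : (Sect2.domSys P M j).Dom) :
    (Sect2.towerOfTerms S Rz' M Ω' t').spaceB j X = (Sect2.towerOfTerms S Rz M Ω t).spaceB j X := by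
  show Sect2.spaceMS S Rz' M j _ Ω' = Sect2.spaceMS S Rz M j _ Ω
  unfold Sect2.spaceMS Sect2.frameMS
  rw [hbg, layerSet_congr_of_agree j _ (fun i hi => hΩ i (Nat.le_succ_of_le hi)), cubesMS_congr_of_agree M j _ hΩ]

/-- **… SO AT LEVEL `1` THE SPACE `Ũ^c_1(X)` OF AN EXPANSION CHILD IS THE PARENT'S** (two residuals with the same `bgMS`, `Ω₀ = Ω′₀ = ∅`, `Ω′₁ = Ω₁`; any term values): the
old boundary term `𝐁^{(1)}`'s laws DO transfer at `k = 1` (`…Sect3SupplySplice.o1_one_of_lawsRT`). [cite: Balaban1988Convergent, (2.34)–(2.39), (2.41)(ii) p.261 (bookkeeping)] -/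
theorem towerOfTerms_spaceB_one_eq_of_agree (S : Sect2.Setting 𝔸 G) {Rz Rz' : Sect2.Residual P 𝔸} (hbg : Rz'.bgMS = Rz.bgMS) {Ω Ω' : ℕ → Set (Site P 0)}
    (h0 : Ω 0 = ∅) (h0' : Ω' 0 = ∅) (h1 : Ω' 1 = Ω 1) (t t' : Sect2.TermValues P 𝔸 V M) (X : (Sect2.domSys P M 1).Dom) :
    (Sect2.towerOfTerms S Rz' M Ω' t').spaceB 1 X = (Sect2.towerOfTerms S Rz M Ω t).spaceB 1 X := by
  show Sect2.spaceMS S Rz' M 1 _ Ω' = Sect2.spaceMS S Rz M 1 _ Ω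
  unfold Sect2.spaceMS Sect2.frameMS
  have h01 : ∀ i, i ≤ 1 → Ω' i = Ω i := fun i hi => by
    rcases Nat.of_le_succ hi with hi' | rfl
    · obtain rfl : i = 0 := Nat.le_zero.mp hi'
      rw [h0, h0']
    · exact h1
  rw [hbg, layerSet_congr_of_agree 1 _ h01, cubesMS_one_congr M _ h0 h0' h1]

end SpaceB

/-! ## §2  The law package of a spliced witness across frames -/

section CrossFrame

variable {P : Params} {𝔸 : Type*} [NormedRing 𝔸] [NormedAlgebra ℂ 𝔸] [CompleteSpace 𝔸] {V : Type*} {M : ℕ} {G : Type*} [GaugeGroup G]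

/-- **★ THE 𝐓-IMAGE LAW PACKAGE OF A SPLICED WITNESS ACROSS FRAMES.**  PARENT frame `(S, Rz, M, Ω)` carrying the inductive assumptions `Sect2.LawsRT (tower … t) … k` of the old
witness `t`; CHILD frame `(S, Rz′, M, Ω′)` with `Rz′.bgI = Rz.bgI`, `Rz′.bgMS = Rz.bgMS`, `Ω′_i = Ω_i` for `i ≤ k`; new witness `t′` agreeing with `t` in `𝐄 ∕ 𝐑` at the levels
`≤ k` and in `𝐁` at the levels `< k`.  THEN `Sect2.LawsT (tower S Rz′ M Ω′ t′) … k` holds as soon as, ON THE CHILD FRAME: the level-`k` boundary term `t′.B k` obeys (2.42) and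
(2.41)(ii) (`hBk ∕ hBkA`, void at `k = 0` — NOT inherited: `Ũ^c_k(X)` reads `Ω′_{k+1}`, LOCATED-SPACEB), r11's new-term obligations `Step.LFNewTerms … k` hold for `t′`
(`hnew`) and `t′` is analytic at `k+1` (`hanE ∕ hanR ∕ hanB`).  Every other old-level clause transfers: `U^c_j(X, α₀, α₁)` reads `bgI` and no history
(`towerOfTerms_space_eq_of_bgI_eq`), `Ũ^c_j(X)` for `j < k` reads `Ω_{≤ k}` (§1), `𝐃_j ∕ d_j ∕ agreeOn ∕ act ∕ flow` are the setting's.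
[cite: Balaban1988Convergent, §2 p.262, (2.27)–(2.28) p.259, (2.30)–(2.31) p.260, (2.34)–(2.42) p.261, §3 p.279] -/
theorem lawsT_towerOfTerms_crossFrame (S : Sect2.Setting 𝔸 G) {Rz Rz' : Sect2.Residual P 𝔸} (hbgI : Rz'.bgI = Rz.bgI) (hbgMS : Rz'.bgMS = Rz.bgMS)
    {Ω Ω' : ℕ → Set (Site P 0)} {k : ℕ} (hΩ : ∀ i, i ≤ k → Ω' i = Ω i) {t t' : Sect2.TermValues P 𝔸 V M}
    (hE : ∀ j, j ≤ k → ∀ X z g φ, t'.E j X z g φ = t.E j X z g φ) (hR : ∀ j, j ≤ k → ∀ X φ, t'.R j X φ = t.R j X φ)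
    (hB : ∀ j, j < k → ∀ X φ a, t'.B j X φ a = t.B j X φ a)
    (h : Sect2.LawsRT (Sect2.towerOfTerms S Rz M Ω t) S.lf k)
    (hBk : 1 ≤ k → ∀ (X : (Sect2.domSys P M k).Dom) φ a, φ ∈ (Sect2.towerOfTerms S Rz' M Ω' t').spaceB k X →
      ‖t'.B k X φ a‖ ≤ S.lf.B₀ * Real.exp (-S.lf.κ * (Sect2.domSys P M k).dj X))
    (hBkA : 1 ≤ k → ∀ (X : (Sect2.domSys P M k).Dom) a, AnalyticOnNhd ℂ (fun φ => t'.B k X φ a) ((Sect2.towerOfTerms S Rz' M Ω' t').spaceB k X))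
    (hnew : LFNewTerms (Sect2.towerOfTerms S Rz' M Ω' t') S.lf S.βc k)
    (hanE : ∀ (X : (Sect2.domSys P M (k + 1)).Dom) z g, 0 ≤ g → g ≤ S.lf.γ →
      AnalyticOnNhd ℂ (t'.E (k + 1) X z g) ((Sect2.towerOfTerms S Rz' M Ω' t').space (k + 1) X (S.lf.alpha0 (S.flow.g (k + 1))) (S.lf.alpha1 (S.flow.g (k + 1)))))
    (hanR : ∀ X : (Sect2.domSys P M (k + 1)).Dom,
      AnalyticOnNhd ℂ (t'.R (k + 1) X) ((Sect2.towerOfTerms S Rz' M Ω' t').space (k + 1) X (S.lf.alpha0 (S.flow.g (k + 1))) (S.lf.alpha1 (S.flow.g (k + 1)))))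
    (hanB : ∀ (X : (Sect2.domSys P M (k + 1)).Dom) a, AnalyticOnNhd ℂ (fun φ => t'.B (k + 1) X φ a) ((Sect2.towerOfTerms S Rz' M Ω' t').spaceB (k + 1) X)) :
    Sect2.LawsT (Sect2.towerOfTerms S Rz' M Ω' t') S.lf S.βc k := by
  obtain ⟨hH, hA⟩ := h
  have hsp : ∀ (j : ℕ) (X : (Sect2.domSys P M j).Dom) (α₀ α₁ : ℝ),
      (Sect2.towerOfTerms S Rz' M Ω' t').space j X α₀ α₁ = (Sect2.towerOfTerms S Rz M Ω t).space j X α₀ α₁ :=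
    fun j X α₀ α₁ => towerOfTerms_space_eq_of_bgI_eq S hbgI Ω Ω' t t' j X α₀ α₁
  have hspB : ∀ j, j < k → ∀ X : (Sect2.domSys P M j).Dom,
      (Sect2.towerOfTerms S Rz' M Ω' t').spaceB j X = (Sect2.towerOfTerms S Rz M Ω t).spaceB j X :=
    fun j hj X => towerOfTerms_spaceB_eq_of_agree S hbgMS (fun i hi => hΩ i (by omega)) t t' X
  refine ⟨⟨hH.rg, fun j h1 hj X z g φ ψ hφψ => ?_, fun j h1 hj X φ ψ hφψ => ?_, fun j h1 hj X z g φ hg0 hgγ hφ => ?_,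
    fun j h1 hj X φ hφ => ?_, fun j h1 hj X φ a hφ => ?_, fun j h1 hj X z g u φ => ?_, fun j h1 hj X u φ => ?_⟩, hnew,
    ⟨fun j h1 hj X z g hg0 hgγ => ?_, fun j h1 hj X => ?_, fun j h1 hj X a => ?_⟩⟩
  · show t'.E j X z g φ = t'.E j X z g ψ
    rw [hE j hj, hE j hj]; exact hH.localDepE j h1 hj X z g φ ψ hφψ
  · show t'.R j X φ = t'.R j X ψ
    rw [hR j hj, hR j hj]; exact hH.localDepR j h1 hj X φ ψ hφψ
  · show ‖t'.E j X z g φ‖ ≤ _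
    rw [hE j hj]; rw [hsp] at hφ; exact hH.boundE j h1 hj X z g φ hg0 hgγ hφ
  · show ‖t'.R j X φ‖ ≤ _
    rw [hR j hj]; rw [hsp] at hφ; exact hH.boundR j h1 hj X φ hφ
  · show ‖t'.B j X φ a‖ ≤ _
    rcases Nat.lt_or_ge j k with hjk | hjk
    · rw [hB j hjk]; rw [hspB j hjk] at hφ; exact hH.boundB j h1 hj X φ a hφ
    · obtain rfl : j = k := le_antisymm hj hjk
      exact hBk h1 X φ a hφ
  · show t'.E j X z g _ = t'.E j X z g φ
    rw [hE j hj, hE j hj]; exact hH.gaugeInvE j h1 hj X z g u φ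
  · show t'.R j X _ = t'.R j X φ
    rw [hR j hj, hR j hj]; exact hH.gaugeInvR j h1 hj X u φ
  · rcases Nat.of_le_succ hj with hj' | rfl
    · have hfun : (Sect2.towerOfTerms S Rz' M Ω' t').E j X z g = (Sect2.towerOfTerms S Rz M Ω t).E j X z g :=
        funext fun φ => hE j hj' X z g φ
      rw [hfun, hsp]; exact hA.analyticE j h1 hj' X z g hg0 hgγ
    · exact hanE X z g hg0 hgγ
  · rcases Nat.of_le_succ hj with hj' | rfl
    · have hfun : (Sect2.towerOfTerms S Rz' M Ω' t').R j X = (Sect2.towerOfTerms S Rz M Ω t).R j X := funext fun φ => hR j hj' X φ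
      rw [hfun, hsp]; exact hA.analyticR j h1 hj' X
    · exact hanR X
  · rcases Nat.of_le_succ hj with hj' | rfl
    · rcases Nat.lt_or_ge j k with hjk | hjk
      · have hfun : (fun φ => (Sect2.towerOfTerms S Rz' M Ω' t').B j X φ a) = fun φ => (Sect2.towerOfTerms S Rz M Ω t).B j X φ a :=
          funext fun φ => hB j hjk X φ a
        rw [hfun, hspB j hjk]; exact hA.analyticB j h1 hj' X a
      · obtain rfl : j = k := le_antisymm hj' hjk
        exact hBkA h1 X a
    · exact hanB X a

/-- **r11's NEW-TERM PACKAGE DOES NOT READ THE LEVELS `≤ k`**: on one frame it transports from `u` to `graftAbove k t u` (whose level-`(k+1)` terms are `u`'s; spaces, `𝐃_{k+1}`,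
`agreeOn`, `act`, flow are the frame's). [cite: Balaban1988Convergent, §2 p.262 (bookkeeping)] -/
theorem lfNewTerms_graftAbove (S : Sect2.Setting 𝔸 G) (Rz : Sect2.Residual P 𝔸) (Ω : ℕ → Set (Site P 0)) {k : ℕ} {t u : Sect2.TermValues P 𝔸 V M}
    (h : LFNewTerms (Sect2.towerOfTerms S Rz M Ω u) S.lf S.βc k) : LFNewTerms (Sect2.towerOfTerms S Rz M Ω (graftAbove k t u)) S.lf S.βc k := by
  have hlt := Nat.lt_succ_self k
  refine ⟨h.rg, fun X z g φ ψ hφψ => ?_, fun X φ ψ hφψ => ?_, fun X z g v φ => ?_, fun X v φ => ?_, ⟨fun h1 X z g φ hg0 hgγ hφ => ?_, fun h1 X φ hφ => ?_, fun h1 X φ a hφ => ?_⟩⟩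
  · show (graftAbove k t u).E (k + 1) X z g φ = (graftAbove k t u).E (k + 1) X z g ψ
    rw [graftAbove_E_of_lt t u hlt, graftAbove_E_of_lt t u hlt]; exact h.localDepE X z g φ ψ hφψ
  · show (graftAbove k t u).R (k + 1) X φ = (graftAbove k t u).R (k + 1) X ψ
    rw [graftAbove_R_of_lt t u hlt, graftAbove_R_of_lt t u hlt]; exact h.localDepR X φ ψ hφψ
  · show (graftAbove k t u).E (k + 1) X z g _ = (graftAbove k t u).E (k + 1) X z g φ
    rw [graftAbove_E_of_lt t u hlt, graftAbove_E_of_lt t u hlt]; exact h.gaugeInvE X z g v φ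
  · show (graftAbove k t u).R (k + 1) X _ = (graftAbove k t u).R (k + 1) X φ
    rw [graftAbove_R_of_lt t u hlt, graftAbove_R_of_lt t u hlt]; exact h.gaugeInvR X v φ
  · show ‖(graftAbove k t u).E (k + 1) X z g φ‖ ≤ _
    rw [graftAbove_E_of_lt t u hlt]; exact h.improved.boundE h1 X z g φ hg0 hgγ hφ
  · show ‖(graftAbove k t u).R (k + 1) X φ‖ ≤ _
    rw [graftAbove_R_of_lt t u hlt]; exact h.improved.boundR h1 X φ hφ
  · show ‖(graftAbove k t u).B (k + 1) X φ a‖ ≤ _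
    rw [graftAbove_B_of_lt t u hlt]; exact h.improved.boundB h1 X φ a hφ

end CrossFrame

/-! ## §3  Zero new terms -/

section ZeroNew

variable {P : Params} {𝔸 : Type*} [NormedRing 𝔸] [NormedAlgebra ℂ 𝔸] [CompleteSpace 𝔸] {V : Type*} {M : ℕ} {G : Type*} [GaugeGroup G]

/-- **THE FOUR LEVEL-`(k+1)` 𝐄-CLAUSES FOR `𝐄^{(k+1)} ≡ 0`** (local dependence, gauge invariance, the improved bound from `0 ≤ E₀`, analyticity of a constant) — the shape
consumed by `lfNewTerms_of_newE_of_noR_of_noB` and produced, for a genuine `𝐄^{(k+1)}`, by `…RePinnedUnivECoPH.newEClauses_of_lawsT_of_eqE`.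
[cite: Balaban1988Convergent, (2.27)–(2.28) p.259, §2 p.262, (3.25) p.270 (bookkeeping)] -/
theorem newEClauses_of_zeroE (S : Sect2.Setting 𝔸 G) (Rz' : Sect2.Residual P 𝔸) (Ω' : ℕ → Set (Site P 0)) {k : ℕ} {t' : Sect2.TermValues P 𝔸 V M}
    (hE' : ∀ X z g φ, t'.E (k + 1) X z g φ = 0) (hE₀ : 0 ≤ S.lf.E₀) :
    (∀ X z g φ ψ, (Sect2.towerOfTerms S Rz' M Ω' t').agreeOn (k + 1) X φ ψ → t'.E (k + 1) X z g φ = t'.E (k + 1) X z g ψ) ∧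
    (∀ X z g u φ, t'.E (k + 1) X z g ((Sect2.towerOfTerms S Rz' M Ω' t').act u φ) = t'.E (k + 1) X z g φ) ∧
    (∀ X z g φ, 0 ≤ g → g ≤ S.lf.γ →
      φ ∈ (Sect2.towerOfTerms S Rz' M Ω' t').space (k + 1) X (S.lf.alpha0 (S.flow.g (k + 1))) (S.lf.alpha1 (S.flow.g (k + 1))) →
        ‖t'.E (k + 1) X z g φ‖ ≤ S.lf.E₀ * Real.exp (-((1 + 4 * S.βc) * S.lf.κ) * (Sect2.domSys P M (k + 1)).dj X)) ∧
    (∀ X z g, 0 ≤ g → g ≤ S.lf.γ →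
      AnalyticOnNhd ℂ (t'.E (k + 1) X z g)
        ((Sect2.towerOfTerms S Rz' M Ω' t').space (k + 1) X (S.lf.alpha0 (S.flow.g (k + 1))) (S.lf.alpha1 (S.flow.g (k + 1))))) := by
  refine ⟨fun X z g φ ψ _ => by rw [hE', hE'], fun X z g u φ => by rw [hE', hE'], fun X z g φ _ _ _ => ?_, fun X z g _ _ => ?_⟩
  · rw [hE', norm_zero]; exact mul_nonneg hE₀ (Real.exp_nonneg _)
  · have hfun : t'.E (k + 1) X z g = fun _ => 0 := funext fun φ => hE' X z g φ
    rw [hfun]; exact analyticOnNhd_const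

/-- **r11's NEW-TERM PACKAGE FOR A WITNESS WITHOUT `𝐑^{(k+1)} ∕ 𝐁^{(k+1)}`** from the four 𝐄-clauses at `k+1`, the RG equation at `k`, `0 ≤ B₀` and `0 ≤ g_{k+1}` (the
zero values obey the improved bounds). [cite: Balaban1988Convergent, §2 p.262, (2.30)–(2.31) p.260, (2.41)–(2.42) p.261, (3.25) p.270; Balaban1987RG1, (0.20) p.256] -/
theorem lfNewTerms_of_newE_of_noR_of_noB (S : Sect2.Setting 𝔸 G) (Rz' : Sect2.Residual P 𝔸) (Ω' : ℕ → Set (Site P 0)) {k : ℕ} {t' : Sect2.TermValues P 𝔸 V M}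
    (hrg : 1 / (S.flow.g k) ^ 2 = 1 / (S.flow.g (k + 1)) ^ 2 + S.flow.β (k + 1) (S.flow.g k))
    (hR' : ∀ X φ, t'.R (k + 1) X φ = 0) (hB' : ∀ X φ a, t'.B (k + 1) X φ a = 0)
    (hlocE : ∀ X z g φ ψ, (Sect2.towerOfTerms S Rz' M Ω' t').agreeOn (k + 1) X φ ψ → t'.E (k + 1) X z g φ = t'.E (k + 1) X z g ψ)
    (hinvE : ∀ X z g u φ, t'.E (k + 1) X z g ((Sect2.towerOfTerms S Rz' M Ω' t').act u φ) = t'.E (k + 1) X z g φ)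
    (hbdE : ∀ X z g φ, 0 ≤ g → g ≤ S.lf.γ →
      φ ∈ (Sect2.towerOfTerms S Rz' M Ω' t').space (k + 1) X (S.lf.alpha0 (S.flow.g (k + 1))) (S.lf.alpha1 (S.flow.g (k + 1))) →
        ‖t'.E (k + 1) X z g φ‖ ≤ S.lf.E₀ * Real.exp (-((1 + 4 * S.βc) * S.lf.κ) * (Sect2.domSys P M (k + 1)).dj X))
    (hB₀ : 0 ≤ S.lf.B₀) (hg : 0 ≤ S.flow.g (k + 1)) :
    LFNewTerms (Sect2.towerOfTerms S Rz' M Ω' t') S.lf S.βc k := by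
  refine ⟨hrg, hlocE, fun X φ ψ _ => ?_, hinvE, fun X u φ => ?_,
    ⟨fun _ X z g φ hg0 hgγ hφ => hbdE X z g φ hg0 hgγ hφ, fun _ X φ _ => ?_, fun _ X φ a _ => ?_⟩⟩
  · show t'.R (k + 1) X φ = t'.R (k + 1) X ψ
    rw [hR', hR']
  · show t'.R (k + 1) X _ = t'.R (k + 1) X φ
    rw [hR', hR']
  · show ‖t'.R (k + 1) X φ‖ ≤ _
    rw [hR', norm_zero]; exact mul_nonneg (pow_nonneg hg _) (Real.exp_nonneg _)
  · show ‖t'.B (k + 1) X φ a‖ ≤ _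
    rw [hB', norm_zero]; exact mul_nonneg hB₀ (Real.exp_nonneg _)

omit [CompleteSpace 𝔸] in
/-- A vanishing `𝐑^{(j)}` is analytic on any set. [cite: Balaban1988Convergent, (2.30) p.260 (bookkeeping)] -/
theorem analyticR_of_noR {t' : Sect2.TermValues P 𝔸 V M} {j : ℕ} (hR' : ∀ X φ, t'.R j X φ = 0) (X : (Sect2.domSys P M j).Dom) (U : Set (Sect2.CPair P 𝔸)) :
    AnalyticOnNhd ℂ (t'.R j X) U := by
  have hfun : t'.R j X = fun _ => 0 := funext fun φ => hR' X φ
  rw [hfun]; exact analyticOnNhd_const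

omit [CompleteSpace 𝔸] in
/-- A vanishing `𝐁^{(j)}` is analytic on any set. [cite: Balaban1988Convergent, (2.41)(ii) p.261 (bookkeeping)] -/
theorem analyticB_of_noB {t' : Sect2.TermValues P 𝔸 V M} {j : ℕ} (hB' : ∀ X φ a, t'.B j X φ a = 0) (X : (Sect2.domSys P M j).Dom) (a : SFluct P V)
    (U : Set (Sect2.CPair P 𝔸)) : AnalyticOnNhd ℂ (fun φ => t'.B j X φ a) U := by
  have hfun : (fun φ => t'.B j X φ a) = fun _ => (0 : ℂ) := funext fun φ => hB' X φ a
  rw [hfun]; exact analyticOnNhd_const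

end ZeroNew

/-! ## §4 (v1.1)  `Ũ^c_j(X)` IS ANTITONE IN THE (2.38) CUBE FAMILY, HENCE IN `Ω_{j+1}`: LOCATED-SPACEB EXACT (the parent's `Ũ^c_k(X)` sits INSIDE the expansion child's), and the
(O1)-FREE cross-frame law package whenever the child's `Ũ^c_k(X)` sits inside the parent's (as under the p. 262 reading «newly created terms … defined on slightly larger
spaces»: a parent frame extended by `Ω_{k+1} := Ω_k` beyond its window has FEWER layer-`(k−1)` cubes than any child, so every child's space is inside it) -/

section Antitone

variable {P : Params} {i : ℕ} {𝔸 : Type*} [NormedRing 𝔸] [NormedAlgebra ℂ 𝔸] [CompleteSpace 𝔸]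

/-- **THE SPACE `Ũ^c_j(X, α̃₀, α̃₁)` IS ANTITONE IN THE (2.38) CUBE FAMILY**: condition (ii) is one requirement per cube, so MORE cubes cut out a SMALLER space; two multi-scale frames
with the same `X`, layers and background functions and cube families `cubes′ ⊆ cubes` (layer-wise) have `space234 (cubes) ⊆ space234 (cubes′)`. [cite: Balaban1988Convergent, (2.38) p.261 (bookkeeping)] -/
theorem space234_antitone_cubes (𝓜 : B12RegularSpaces111.Model 𝔸) (X : B12RegularSpaces111.Region P i) (layer : ℕ → B12RegularSpaces111.Region P i)
    (bg : B14RegularSpaces234.MSBackgroundFns P i 𝔸) {cubes cubes' : ℕ → Set (B12RegularSpaces111.Region P i)} (h : ∀ n, cubes' n ⊆ cubes n)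
    (c : B14RegularSpaces234.MSConsts) (α₀ α₁ : ℕ → ℝ) :
    B14RegularSpaces234.space234 𝓜 ⟨X, layer, cubes, bg⟩ c α₀ α₁ ⊆ B14RegularSpaces234.space234 𝓜 ⟨X, layer, cubes', bg⟩ c α₀ α₁ := by
  intro Φ hΦ
  obtain ⟨hU, hJ, U, A', hfac, hI, hII, hIII⟩ := hΦ
  exact ⟨hU, hJ, U, A', hfac, ⟨hI.gValued, hI.plaq_lt, hI.plaqU_lt, hI.plaqP_lt, hI.J_lt, hI.JP_lt⟩,
    ⟨fun n h1 hn C hC => hII.localGauge n h1 hn C (h n hC)⟩, ⟨hIII.gcValued, hIII.norm_lt, hIII.nabla_lt⟩⟩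

/-- **A BIGGER `Ω_{j+1}` GIVES FEWER (2.38) CUBES AT LEVEL `j`** (two sequences agreeing up to `j`, `Ω′_{j+1} ⊆ Ω_{j+1}`): the layer-`n` families for `n + 2 ≤ j` and `n = j` coincide,
and at `n = j−1` a cube «□ ⊂ Ω_{j−1}∖Ω_{j+1}» is one «□ ⊂ Ω′_{j−1}∖Ω′_{j+1}». [cite: Balaban1988Convergent, (2.38) p.261 (bookkeeping)] -/
theorem cubesMS_mono_of_succ_subset (M j : ℕ) (Y : Set (Site P 0)) {Ω Ω' : ℕ → Set (Site P 0)} (hΩ : ∀ i, i ≤ j → Ω' i = Ω i)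
    (hsucc : Ω' (j + 1) ⊆ Ω (j + 1)) (n : ℕ) : Sect2.cubesMS M j Y Ω n ⊆ Sect2.cubesMS M j Y Ω' n := by
  intro C hC
  simp only [Sect2.cubesMS, Set.mem_setOf_eq] at hC ⊢
  obtain ⟨a, ha, hne, hcond, hCdef⟩ := hC
  refine ⟨a, ha, hne, ?_, hCdef⟩
  rcases hcond with ⟨hn, hsub, hne'⟩ | ⟨hn, hsub⟩
  · have hn0 : Ω' n = Ω n := hΩ n hn.le
    have hn1 : Ω' (n + 1) = Ω (n + 1) := hΩ (n + 1) hn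
    refine Or.inl ⟨hn, fun x hx => ?_, by rw [hn1]; exact hne'⟩
    have hx' := hsub hx
    refine ⟨by rw [hn0]; exact hx'.1, fun hx2 => hx'.2 ?_⟩
    rcases Nat.lt_or_ge (n + 2) (j + 1) with hlt | hge
    · rw [← hΩ (n + 2) (by omega)]; exact hx2
    · obtain h2 : n + 2 = j + 1 := by omega
      rw [h2] at hx2 ⊢; exact hsucc hx2
  · exact Or.inr ⟨hn, by rw [hΩ j le_rfl]; exact hsub⟩

variable {V : Type*} {M : ℕ} {G : Type*} [GaugeGroup G]

/-- **`Ũ^c_j(X)` OF THE §2 TOWER IS ANTITONE IN `Ω_{j+1}`** (two sequences agreeing up to `j`, two residuals with the same `bgMS`, any term values): the tower along the sequence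
with the SMALLER `Ω_{j+1}` has the smaller space. [cite: Balaban1988Convergent, (2.34)–(2.39), (2.41)(ii) p.261 (bookkeeping)] -/
theorem towerOfTerms_spaceB_subset_of_succ_subset (S : Sect2.Setting 𝔸 G) {Rz Rz' : Sect2.Residual P 𝔸} (hbg : Rz'.bgMS = Rz.bgMS) {Ω Ω' : ℕ → Set (Site P 0)}
    {j : ℕ} (hΩ : ∀ i, i ≤ j → Ω' i = Ω i) (hsucc : Ω' (j + 1) ⊆ Ω (j + 1)) (t t' : Sect2.TermValues P 𝔸 V M) (X : (Sect2.domSys P M j).Dom) :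
    (Sect2.towerOfTerms S Rz' M Ω' t').spaceB j X ⊆ (Sect2.towerOfTerms S Rz M Ω t).spaceB j X := by
  show Sect2.spaceMS S Rz' M j _ Ω' ⊆ Sect2.spaceMS S Rz M j _ Ω
  unfold Sect2.spaceMS Sect2.frameMS
  rw [hbg, layerSet_congr_of_agree j _ hΩ]
  exact Set.image_mono (space234_antitone_cubes S.𝓜 _ _ _ (cubesMS_mono_of_succ_subset M j _ hΩ hsucc) _ _ _)

/-- **LOCATED-SPACEB, EXACT: THE PARENT's `Ũ^c_k(X)` SITS INSIDE EVERY EXPANSION CHILD's** (parent `Ω_{k+1} = ∅` by r11's off-window convention; the child agrees up to `k`):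
the inductive assumption (2.42)∕(2.41)(ii) for the old `𝐁^{(k)}`, stated on the parent's space, is implied by — and does NOT imply — the law on the child's space that
`Sect2.LawsT … k` at the child asks ((O1)). [cite: Balaban1988Convergent, (2.38), (2.41)–(2.42) p.261, (2.1) p.254 (bookkeeping)] -/
theorem towerOfTerms_spaceB_parent_subset_child (S : Sect2.Setting 𝔸 G) {Rzp Rzc : Sect2.Residual P 𝔸} (hbg : Rzp.bgMS = Rzc.bgMS) {Ωp Ωc : ℕ → Set (Site P 0)}
    {k : ℕ} (hΩ : ∀ i, i ≤ k → Ωp i = Ωc i) (h0 : Ωp (k + 1) = ∅) (tp tc : Sect2.TermValues P 𝔸 V M) (X : (Sect2.domSys P M k).Dom) :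
    (Sect2.towerOfTerms S Rzp M Ωp tp).spaceB k X ⊆ (Sect2.towerOfTerms S Rzc M Ωc tc).spaceB k X :=
  towerOfTerms_spaceB_subset_of_succ_subset S hbg hΩ (by rw [h0]; exact Set.empty_subset _) tc tp X

/-- **★ THE (O1)-FREE CROSS-FRAME LAW PACKAGE**: §2's `lawsT_towerOfTerms_crossFrame` with the level-`k` boundary obligation DISCHARGED whenever the child's `Ũ^c_k(X)` sits
inside the parent's (`hsub`) and `t′` keeps `t`'s `𝐁` at ALL levels `≤ k`: (2.42) restricts and (2.41)(ii) restricts (`AnalyticOnNhd.mono`).  Under the p. 262 reading of the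
parent frame (`Ω_{k+1} := Ω_k` beyond the window) `hsub` is `towerOfTerms_spaceB_subset_of_succ_subset`; under r11's zero-extension it FAILS at `k ≥ 2` (previous theorem).
[cite: Balaban1988Convergent, §2 p.262, (2.38), (2.41)–(2.42) p.261, §3 p.279] -/
theorem lawsT_towerOfTerms_crossFrame_of_spaceB_subset (S : Sect2.Setting 𝔸 G) {Rz Rz' : Sect2.Residual P 𝔸} (hbgI : Rz'.bgI = Rz.bgI) (hbgMS : Rz'.bgMS = Rz.bgMS)
    {Ω Ω' : ℕ → Set (Site P 0)} {k : ℕ} (hΩ : ∀ i, i ≤ k → Ω' i = Ω i) {t t' : Sect2.TermValues P 𝔸 V M}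
    (hE : ∀ j, j ≤ k → ∀ X z g φ, t'.E j X z g φ = t.E j X z g φ) (hR : ∀ j, j ≤ k → ∀ X φ, t'.R j X φ = t.R j X φ)
    (hB : ∀ j, j ≤ k → ∀ X φ a, t'.B j X φ a = t.B j X φ a)
    (h : Sect2.LawsRT (Sect2.towerOfTerms S Rz M Ω t) S.lf k)
    (hsub : ∀ X : (Sect2.domSys P M k).Dom, (Sect2.towerOfTerms S Rz' M Ω' t').spaceB k X ⊆ (Sect2.towerOfTerms S Rz M Ω t).spaceB k X)
    (hnew : LFNewTerms (Sect2.towerOfTerms S Rz' M Ω' t') S.lf S.βc k)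
    (hanE : ∀ (X : (Sect2.domSys P M (k + 1)).Dom) z g, 0 ≤ g → g ≤ S.lf.γ →
      AnalyticOnNhd ℂ (t'.E (k + 1) X z g) ((Sect2.towerOfTerms S Rz' M Ω' t').space (k + 1) X (S.lf.alpha0 (S.flow.g (k + 1))) (S.lf.alpha1 (S.flow.g (k + 1)))))
    (hanR : ∀ X : (Sect2.domSys P M (k + 1)).Dom,
      AnalyticOnNhd ℂ (t'.R (k + 1) X) ((Sect2.towerOfTerms S Rz' M Ω' t').space (k + 1) X (S.lf.alpha0 (S.flow.g (k + 1))) (S.lf.alpha1 (S.flow.g (k + 1)))))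
    (hanB : ∀ (X : (Sect2.domSys P M (k + 1)).Dom) a, AnalyticOnNhd ℂ (fun φ => t'.B (k + 1) X φ a) ((Sect2.towerOfTerms S Rz' M Ω' t').spaceB (k + 1) X)) :
    Sect2.LawsT (Sect2.towerOfTerms S Rz' M Ω' t') S.lf S.βc k :=
  lawsT_towerOfTerms_crossFrame S hbgI hbgMS hΩ hE hR (fun j hj => hB j hj.le) h
    (fun h1 X φ a hφ => by rw [hB k le_rfl]; exact h.1.boundB k h1 le_rfl X φ a (hsub X hφ))
    (fun h1 X a => by
      rw [show (fun φ => t'.B k X φ a) = fun φ => t.B k X φ a from funext fun φ => hB k le_rfl X φ a]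
      exact (h.2.analyticB k h1 le_rfl X a).mono (hsub X))
    hnew hanE hanR hanB

end Antitone

end Summit.QuantumFields.YangMills.Theorems.BalabanUVNodesN11Sect3SupplySpliceFrame

end
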